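import Summits.BirchSwinnertonDyer.Rank1Residual.AdditivePotMult.MixedCongruentPartnerEPW
import HarnessLib

/-!
# Route G at an X4♯(G-ord, e = 2) row from a congruent partner of EITHER type ((G-ord) or (M)), WITH
# THE RAMIFIED ORDINARY LINES DISCHARGED and the partner input in RANK currency: budgets and K-C′
# (cell `b2b-bsdres`, team n1011, seat p07 (gen 5), OWNERS row T-E3d-MIX FILE 2; sequel of
# `MixedCongruentPartnerEPW.lean`, of n1011-p10's `CongruentPartnerMainConjectureGordEPW[TorsionIso]`
# and of p07's C′ `RamifiedOrdinaryLineMatchingMixed`)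

HONEST FRAMING (cell `b2b-bsdres`, run/shared/lean/b2b/bsd-rank1-residual/, verbatim in every
file): the goal of the cell is to DELETE the COMBINATION-SHAPED residual classes of the
Birch–Swinnerton-Dyer formula for ALL analytic-rank `≤ 1` elliptic curves over `ℚ` — "full BSD
formula for every rank `≤ 1` curve in class `C`" assembled STRICTLY from published theorems — so
that the rank-`≤ 1` remainder becomes exactly the CONSTRUCTION-SHAPED classes, which are TYPED
(missing-input `Prop`s), NOT attempted. This is not "finishing BSD". Team n1011 (RESIDUAL-MAP §I
N10 / N11 LOWER; Route G's per-pair EPW consumers on X4♯(G-ord, `e = 2`) rows): research route on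
CONSTRUCTION-SHAPED items; labels and marks UNCHANGED; nothing booked — every statement below is
PER PAIR modulo the named facts and per-pair inputs outside the kernel (congruence = census
`TorsionIso` currency; `Σ₀`; partner rank; unit coefficient = ENGINE value, two-engine rule).
Theorems only; NO definition; NO Literature fact minted. Named facts enter as HYPOTHESES exactly as
in the files consumed, none dropped: `hK` (Kato 2004 Thm. 17.4 (3), half-eigenspace reading), `hEPW`
(Emerton–Pollack–Weston 2006 Thms. 3.3.2 / 3.3.3 (2) + Lemma 5.1.5), `hmodD`, and with an (M)
partner `hT40`/`hT41` (Silverman *ATAEC* V.3.1 / V.5.3 / V.5.4 = A40/A41). Debt 0.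

## What

* §1 BUDGETS of an X4♯(G-ord) ∩ `I₀*` row (`E[p]` irreducible READ OFF X4), lines discharged, partner
  input CONCRETE: `ClassX4Gord.budgetLeLambdaAt_of_epw_of_gordPartner_of_congr` (partner X4♯(G-ord) ∩
  `I₀*` ∧ surj ∧ `rank ≥ r₁`: n1011-p10's `ClassX4Gord.exists_epwLineData_of_torsionIso` + FILE 3 §1
  `budgetLeLambdaAt_of_epw_of_partnerRank` + FILE 1 §1) and
  `ClassX4Gord.budgetLeLambdaAt_of_epw_of_multPartner_of_congr` (partner X4(M) ∧ surj ∧ `rank ≥ r₁`: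
  C′ `exists_lines_matching_of_typeGOrd_potMult` + FILE 3 §1–§2). These feed n1011-p10's
  `ClassX4Gord.bsdp[_three]_rankZero_of_katoHalf_of_coeffCert_of_budget_of_nonAnomalous[_noPal]` and
  `ClassX4Gord.mainConjecture_of_katoHalf_of_coeffCert_of_budget` BY NAME.
* §2 K-C′ (branch main conjecture at `E`, `μ = 0`, `λ(X(E)) = b`, and `μ(X(E₁)) = 0`, `λ(X(E₁)) = r₁`)
  at an X4♯(G-ord) ∩ `I₀*` ∧ surj row: `ClassX4Gord.mainConjecture_of_katoHalf_of_coeffCert_of_epw_of_multPartner`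
  (X4(M) partner, per-datum bound `r₁ ≤ λ(X(E₁))` as in p10's F4), and the RANK-currency forms
  `…_of_multPartner_rank` / `…_of_torsionIso_rank` (partner ∧ surj ∧ `rank ≥ r₁`; the partner's
  torsion and `μ = 0 ⟹ r₁ ≤ λ` by FILE 1 §1 / FILE 3 §2, `μ = 0` transferred from `E`).

What is NOT claimed: X3♯ twins (EPW needs `E[p]` irreducible — r2's ARM α); `e ∈ {3,4,6}`; pairs
with a semistable member; `r_an = 1` ends; `p = 2`. X4♯(G-ord) stays CONSTRUCTION-SHAPED; nothing
booked. READING OF RECORD (referee 1 ACK-1 proviso P1 on Route G): per additive pair EPW 2006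
Thm. 3.3.3 is applied in its `ω^i`-form on the HIDA FAMILY of `ρ̄_{E♭}` at `i = (p−1)/2`, never on
`f_E` itself; `e = B(E,p) − B(E₁,p)`, `b = B(E,p)`.

References: M. Emerton, R. Pollack, T. Weston, Invent. Math. 163 (2006) pp. 2–3, Thms. 3.3.2,
3.3.3, Lemma 5.1.5 [EmertonPollackWeston2006]; K. Kato, Astérisque 295 (2004) Thm. 17.4 (3)
[Kato2004Asterisque]; R. Greenberg, V. Vatsal, Invent. Math. 142 (2000) Thm. (1.4), §2
[GreenbergVatsal2000]; R. Greenberg, LNM 1716 (1999) §3 Lemma 3.1 [GreenbergLNM1716];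
J. H. Silverman, *ATAEC* V.5.3–5.4 [SilvermanATAEC1994]; L. Washington, GTM 83 §13.2 [Washington1997].
-/

set_option autoImplicit false

noncomputable section

open scoped Classical MatrixGroups ModularForm NumberField

open CongruenceSubgroup WeierstrassCurve NumberField IsDedekindDomain Field
  Literature.NumberTheory.EllipticCurves
  Literature.NumberTheory.EllipticCurves.ModularForms
  Literature.NumberTheory.EllipticCurves.Rank1Residual
  Literature.NumberTheory.EllipticCurves.Rank1Residual.Typed
  Literature.NumberTheory.EllipticCurves.GreenbergSelmer
  Literature.NumberTheory.EllipticCurves.Wuthrich2014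
  Literature.NumberTheory.EllipticCurves.GreenbergVatsal2000
  Literature.NumberTheory.EllipticCurves.EmertonPollackWeston2006
  Literature.NumberTheory.GaloisRepresentations
  Summit.BirchSwinnertonDyer.Rank1Residual.X1.MuLambda
  Summit.BirchSwinnertonDyer.Rank1Residual.X11a
  Summit.BirchSwinnertonDyer.Rank1Residual.Iwasawa

open Summit.BirchSwinnertonDyer.Rank1Residual.X1.CongruenceTransfer (TorsionIso CongruentLambdaShift)
open Summit.BirchSwinnertonDyer.Rank1Residual.AdditivePotMult.RamifiedOrdinaryLineMatchingMixed
  (exists_lines_matching_of_typeGOrd_potMult exists_lines_matching_of_potMult_typeGOrd)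
open Summit.BirchSwinnertonDyer.Rank1Residual.AdditivePotMult.MixedCongruentPartnerEPW (exists_place)

/-! ### §1 The budgets of an X4♯(G-ord) ∩ `I₀*` row from a partner of EITHER type -/

namespace Summit.BirchSwinnertonDyer.Rank1Residual.Additive

open Summit.BirchSwinnertonDyer.Rank1Residual.AdditivePotMult

section BudgetG

variable {W W₁ : WeierstrassCurve ℚ} [W.IsElliptic] [W.IsGloballyMinimal] [W₁.IsElliptic]
  [W₁.IsGloballyMinimal] {p : ℕ} [hp : Fact p.Prime]

/-- **The Route-G budget of an X4♯(G-ord) ∩ `I₀*` row from an X4♯(G-ord) ∩ `I₀*` ∧ surj(p)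
congruent partner of rank `≥ r₁` — in RANK currency, lines discharged.** `E = W`, `E₁ = W₁` both of
type (G)-ordinary with semistability defect `2` at the odd prime `p` (class X4: `E[p]` irreducible),
`ρ̄_{E₁,p}` onto, `r₁ ≤ rank E₁(ℚ)`, `TorsionIso W W₁ p`, `Σ₀ ∌ p` outside which both are good:
`BudgetLeLambdaAt p W b` for every `b ≤ r₁ + Σ_{w∈Σ₀} (δ(E₁,w) − δ(E,w))` — the EPW line datum is
n1011-p10's `ClassX4Gord.exists_epwLineData_of_torsionIso`, the transfer is FILE 3 §1
`budgetLeLambdaAt_of_epw_of_partnerRank`, the partner input is FILE 1 §1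
`ClassX4Gord.isTorsion_and_le_lambdaInvariant_of_katoHalf`. Named facts as hypotheses:
`hEPW`, `hK`, `hmodD`. PER PAIR; X4♯(G-ord) stays CONSTRUCTION-SHAPED; nothing booked.
[cite: EmertonPollackWeston2006, Thm. 3.3.2, Thm. 3.3.3 (2) (arXiv:math/0404484 p. 19), Lemma 5.1.5 (p. 30) and p. 3]
[cite: Kato2004Asterisque, Thm. 17.4 (3) (p. 273)] [cite: GreenbergVatsal2000, Thm. (1.4) and §2 p. 26] -/
theorem ClassX4Gord.budgetLeLambdaAt_of_epw_of_gordPartner_of_congr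
    (hEPW : muLambdaAlg_transfer_of_torsionIso_potOrd)
    (hK : Wuthrich2014.kato_halfEigenCharIdeal_dvd_cyclotomicPrime_of_surjective)
    (hmodD : nonempty_modularParametrizationData)
    (hX : ClassX4Gord W p) (he : semistabilityIndex W p = 2)
    (hX₁ : ClassX4Gord W₁ p) (he₁ : semistabilityIndex W₁ p = 2) (hsurj₁ : Surj W₁ p) {r₁ : ℕ}
    (hr₁ : r₁ ≤ W₁.mordellWeilRank) (hT : TorsionIso W W₁ p)
    (S₀ : Finset (HeightOneSpectrum (𝓞 ℚ))) (hS₀ : ∀ w ∈ S₀, ((p : ℕ) : 𝓞 ℚ) ∉ w.asIdeal)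
    (hS : ∀ w : HeightOneSpectrum (𝓞 ℚ), w ∉ S₀ → ((p : ℕ) : 𝓞 ℚ) ∉ w.asIdeal →
      W.HasGoodReductionAt w)
    (hS₁ : ∀ w : HeightOneSpectrum (𝓞 ℚ), w ∉ S₀ → ((p : ℕ) : 𝓞 ℚ) ∉ w.asIdeal →
      W₁.HasGoodReductionAt w)
    {b : ℕ} (hb : (b : ℤ) ≤ r₁ + ∑ w ∈ S₀, ((delta W₁ p w : ℤ) - (delta W p w : ℤ))) :
    BudgetLeLambdaAt p W b := by
  obtain ⟨v, hv⟩ := exists_place p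
  obtain ⟨L, L₁, hL, hL₁, hiso⟩ := hX.exists_epwLineData_of_torsionIso he hX₁ he₁ hT hv
  exact budgetLeLambdaAt_of_epw_of_partnerRank hEPW hX.addv.1 hv hL hL₁ hX.classX4.2.2 hiso S₀ hS₀ hS
    hS₁ (fun hκ hγ hγ' D₁ _ ↦
      hX₁.isTorsion_and_le_lambdaInvariant_of_katoHalf hK hmodD he₁ hsurj₁ hr₁ hκ hγ hγ' D₁) hb

/-- **The Route-G budget of an X4♯(G-ord) ∩ `I₀*` row from an X4(M) ∧ surj(p) congruent partner of
rank `≥ r₁` — lines, matching and partner input discharged.** `E = W` X4♯(G-ord) with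
`semistabilityIndex W p = 2` at the odd prime `p`; partner `E₁ = W₁` X4(M) with `ρ̄_{E₁,p}` onto and
`r₁ ≤ rank E₁(ℚ)` (FILE 3 §2 `ClassX4M.isTorsion_and_le_lambdaInvariant_of_katoHalf`); a PLAIN
`Γ_ℚ`-equivariant `E[p] ≃+ E₁[p]`; `Σ₀ ∌ p` outside which both are good. Then `BudgetLeLambdaAt p W b`
for every `b ≤ r₁ + Σ_{w∈Σ₀} (δ(E₁,w) − δ(E,w))` (C′ `exists_lines_matching_of_typeGOrd_potMult` +
FILE 3 §1). Named facts as hypotheses: `hEPW`, `hK`, `hmodD`, `hT40`, `hT41`. PER PAIR; X4♯(G-ord)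
stays CONSTRUCTION-SHAPED; nothing booked.
[cite: EmertonPollackWeston2006, Thm. 3.3.2, Thm. 3.3.3 (2) (arXiv:math/0404484 p. 19), Lemma 5.1.5 (p. 30) and pp. 2–3]
[cite: Kato2004Asterisque, Thm. 17.4 (3) (p. 273)] [cite: SilvermanATAEC1994, Ch. V Thm. 5.3, Cor. 5.4] -/
theorem ClassX4Gord.budgetLeLambdaAt_of_epw_of_multPartner_of_congr
    (hEPW : muLambdaAlg_transfer_of_torsionIso_potOrd)
    (hK : Wuthrich2014.kato_halfEigenCharIdeal_dvd_cyclotomicPrime_of_surjective)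
    (hmodD : nonempty_modularParametrizationData)
    (hT40 : Silverman1994_thmV53_tateUniformisation.{0})
    (hT41 : Silverman1994_thmV53_corV54_tateUniformisation.{0})
    (hX : ClassX4Gord W p) (he : semistabilityIndex W p = 2)
    (hX₁ : ClassX4M W₁ p) (hsurj₁ : Surj W₁ p) {r₁ : ℕ} (hr₁ : r₁ ≤ W₁.mordellWeilRank)
    (hcong : ∃ e : geomTorsion W (p : ℤ) ≃+ geomTorsion W₁ (p : ℤ),
      ∀ (σ : absoluteGaloisGroup ℚ) (P : geomTorsion W (p : ℤ)), e (σ • P) = σ • e P)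
    (S₀ : Finset (HeightOneSpectrum (𝓞 ℚ))) (hS₀ : ∀ w ∈ S₀, ((p : ℕ) : 𝓞 ℚ) ∉ w.asIdeal)
    (hS : ∀ w : HeightOneSpectrum (𝓞 ℚ), w ∉ S₀ → ((p : ℕ) : 𝓞 ℚ) ∉ w.asIdeal →
      W.HasGoodReductionAt w)
    (hS₁ : ∀ w : HeightOneSpectrum (𝓞 ℚ), w ∉ S₀ → ((p : ℕ) : 𝓞 ℚ) ∉ w.asIdeal →
      W₁.HasGoodReductionAt w)
    {b : ℕ} (hb : (b : ℤ) ≤ r₁ + ∑ w ∈ S₀, ((delta W₁ p w : ℤ) - (delta W p w : ℤ))) :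
    BudgetLeLambdaAt p W b := by
  obtain ⟨v, hv⟩ := exists_place p
  obtain ⟨L, L₁, hL, hL₁, hmatch⟩ := exists_lines_matching_of_typeGOrd_potMult hT40 hT41 hX.addv.1
    hX.typeGOrd hX.addv.2 he (ClassX4M.potMult W₁ p hX₁) hv
  obtain ⟨e, he'⟩ := hcong
  exact budgetLeLambdaAt_of_epw_of_partnerRank hEPW hX.addv.1 hv hL hL₁ hX.classX4.2.2
    ⟨e, he', hmatch e he'⟩ S₀ hS₀ hS hS₁ (fun hκ hγ hγ' D₁ _ ↦
      hX₁.isTorsion_and_le_lambdaInvariant_of_katoHalf hK hmodD hsurj₁ hr₁ hκ hγ hγ' D₁) hb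

end BudgetG

/-! ### §2 K-C′ at an X4♯(G-ord) ∩ `I₀*` ∧ surj row from a partner of EITHER type, lines discharged -/

section MainConjecture

variable {W : WeierstrassCurve ℚ} [W.IsElliptic] [W.IsGloballyMinimal] {p : ℕ} [hp : Fact p.Prime]

/-- **K-C′ from the EPW transfer with an X4(M) partner, line data DISCHARGED.** X4♯(G-ord) ∩ `I₀*` ∩
{`ρ̄_{E,p}` onto}, every odd `p`; a globally minimal CONGRUENT partner `W₁` in X4(M) (`TorsionIso W W₁ p`);
the cited facts `hK`, `hEPW`, `hT40`, `hT41`; `Σ₀ ∌ p` outside which both curves are good; at the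
partner a torsion dual datum with `r₁ ≤ λ(X(E₁))`; at `E` ONE unit coefficient at index
`b = r₁ + Σ_{w∈Σ₀} (δ(E₁,w) − δ(E,w))`. THEN the branch main conjecture at `E` (`char_Λ X = (g)`,
`ι g = C(u·ϖ)·B`, `μ(X(E)) = 0`, `λ(X(E)) = b`) and at the partner `μ(X(E₁)) = 0`, `λ(X(E₁)) = r₁`
(n1011-p10's `ClassX4Gord.mainConjecture_of_katoHalf_of_coeffCert_of_epw`, its line binders `hL`,
`hL₁`, `hiso` SUPPLIED by C′'s `exists_lines_matching_of_typeGOrd_potMult` at `v_p`). READING OF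
RECORD (referee 1 proviso P1): EPW Thm. 3.3.3 in `ω^i`-form on the Hida family of `ρ̄_{E♭}` at
`i = (p−1)/2`; `e = B(E,p) − B(E₁,p)`, `b = B(E,p)`.
[cite: EmertonPollackWeston2006, Thm. 3.3.2, Thm. 3.3.3 (2) (arXiv:math/0404484 p. 19), Lemma 5.1.5 (p. 30), pp. 2–3]
[cite: Kato2004Asterisque, Thm. 17.4 (3) (p. 273)] [cite: SilvermanATAEC1994, Ch. V Thm. 5.3, Cor. 5.4] -/
theorem ClassX4Gord.mainConjecture_of_katoHalf_of_coeffCert_of_epw_of_multPartner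
    (hK : Wuthrich2014.kato_halfEigenCharIdeal_dvd_cyclotomicPrime_of_surjective)
    (hEPW : muLambdaAlg_transfer_of_torsionIso_potOrd)
    (hT40 : Silverman1994_thmV53_tateUniformisation.{0})
    (hT41 : Silverman1994_thmV53_corV54_tateUniformisation.{0})
    (hX : ClassX4Gord W p) (he : semistabilityIndex W p = 2) (hsurj : Surj W p)
    {W₁ : WeierstrassCurve ℚ} [W₁.IsElliptic] [W₁.IsGloballyMinimal]
    (hX₁ : ClassX4M W₁ p) (hT : TorsionIso W W₁ p)
    (S₀ : Finset (HeightOneSpectrum (𝓞 ℚ))) (hS₀ : ∀ w ∈ S₀, ((p : ℕ) : 𝓞 ℚ) ∉ w.asIdeal)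
    (hS : ∀ w : HeightOneSpectrum (𝓞 ℚ), w ∉ S₀ → ((p : ℕ) : 𝓞 ℚ) ∉ w.asIdeal →
      W.HasGoodReductionAt w)
    (hS₁ : ∀ w : HeightOneSpectrum (𝓞 ℚ), w ∉ S₀ → ((p : ℕ) : 𝓞 ℚ) ∉ w.asIdeal →
      W₁.HasGoodReductionAt w)
    {r₁ b : ℕ} (hb : (b : ℤ) = r₁ + ∑ w ∈ S₀, ((delta W₁ p w : ℤ) - (delta W p w : ℤ)))
    (hcert : BranchUnitCoeffAt W p b)
    (V : WeierstrassCurve ℚ) [V.IsElliptic] [V.IsGloballyMinimal] (C : VariableChange ℚ)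
    (hC : C • V.quadraticTwist ((-1 : ℚ) ^ (p / 2) * p) = W) (hV : GoodOrd V p)
    {κ : ZpExtension ℚ p} {γ : Field.absoluteGaloisGroup ℚ} {N : ℕ} [NeZero N]
    {f : CuspForm (Gamma0 N) 2}
    (hκ : κ.IsCyclotomic) (hγ : κ.IsTopGenerator γ) (hcv : IsCyclotomicVariable p γ)
    (hf : IsNewformOf V f) (D : W.SelmerDualData κ γ) (D₁ : W₁.SelmerDualData κ γ)
    (hX₁t : D₁.IsTorsion) (hr₁ : r₁ ≤ lambdaInvariant p D₁.X) (ϖ : ℚ)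
    (hϖ : if Even (p / 2) then (ϖ : ℝ) * V.realPeriodRat = plusPeriod f
      else (ϖ : ℝ) * V.imaginaryPeriodRat = minusPeriod f) :
    (D.IsTorsion ∧ ∃ (g : IwasawaAlgebra p) (u : ℤ_[p]ˣ), D.charIdeal = Ideal.span {g} ∧
      iwasawaToPowerSeries p g =
        PowerSeries.C (((u : ℤ_[p]) : ℚ_[p]) * (ϖ : ℚ_[p])) *
          (if Even (p / 2) then padicLFunctionBranch f ((unitRoot V p : ℤ_[p]) : ℚ_[p]) (p / 2)
            else padicLFunctionMinusBranch f ((unitRoot V p : ℤ_[p]) : ℚ_[p]) (p / 2)) ∧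
      D.mu = 0 ∧ lambdaInvariant p D.X = b) ∧ D₁.mu = 0 ∧ lambdaInvariant p D₁.X = r₁ := by
  obtain ⟨v, hv⟩ := exists_place p
  obtain ⟨L, L₁, hL, hL₁, hmatch⟩ := exists_lines_matching_of_typeGOrd_potMult hT40 hT41 hX.addv.1
    hX.typeGOrd hX.addv.2 he (ClassX4M.potMult W₁ p hX₁) hv
  obtain ⟨e, he'⟩ := hT
  exact hX.mainConjecture_of_katoHalf_of_coeffCert_of_epw hK hEPW he hsurj hv hL hL₁
    ⟨e, he', hmatch e he'⟩ S₀ hS₀ hS hS₁ hb hcert V C hC hV hκ hγ hcv hf D D₁ hX₁t hr₁ ϖ hϖ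

/-- **K-C′ with an X4(M) ∧ surj(p) partner in RANK currency.** As
`ClassX4Gord.mainConjecture_of_katoHalf_of_coeffCert_of_epw_of_multPartner`, the per-datum partner
inputs (`D₁` torsion, `r₁ ≤ λ(X(E₁))`) REPLACED by `ρ̄_{E₁,p}` onto, `hmodD` and `r₁ ≤ rank E₁(ℚ)`:
torsion is FILE 3 §2; `μ(X(E)) = 0` at `E` from Kato half + the unit coefficient
(`ClassX4Gord.isTorsion_and_mu_zero_of_katoHalf_of_coeffCert`) is transferred to the partner by FILE 1
§2 (`mu_eq_zero_of_epw_of_typeGOrd_potMult`),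
whence `r₁ ≤ λ(X(E₁))` by FILE 3 §2 again. Conclusion unchanged. READING OF RECORD (referee 1 proviso
P1) as above. [cite: EmertonPollackWeston2006, Thm. 3.3.2, Thm. 3.3.3 (2) (arXiv:math/0404484 p. 19), Lemma 5.1.5 (p. 30), pp. 2–3]
[cite: Kato2004Asterisque, Thm. 17.4 (3) (p. 273)] [cite: SilvermanATAEC1994, Ch. V Thm. 5.3, Cor. 5.4] -/
theorem ClassX4Gord.mainConjecture_of_katoHalf_of_coeffCert_of_epw_of_multPartner_rank
    (hK : Wuthrich2014.kato_halfEigenCharIdeal_dvd_cyclotomicPrime_of_surjective)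
    (hEPW : muLambdaAlg_transfer_of_torsionIso_potOrd)
    (hmodD : nonempty_modularParametrizationData)
    (hT40 : Silverman1994_thmV53_tateUniformisation.{0})
    (hT41 : Silverman1994_thmV53_corV54_tateUniformisation.{0})
    (hX : ClassX4Gord W p) (he : semistabilityIndex W p = 2) (hsurj : Surj W p)
    {W₁ : WeierstrassCurve ℚ} [W₁.IsElliptic] [W₁.IsGloballyMinimal]
    (hX₁ : ClassX4M W₁ p) (hsurj₁ : Surj W₁ p) {r₁ : ℕ} (hr₁ : r₁ ≤ W₁.mordellWeilRank)
    (hT : TorsionIso W W₁ p)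
    (S₀ : Finset (HeightOneSpectrum (𝓞 ℚ))) (hS₀ : ∀ w ∈ S₀, ((p : ℕ) : 𝓞 ℚ) ∉ w.asIdeal)
    (hS : ∀ w : HeightOneSpectrum (𝓞 ℚ), w ∉ S₀ → ((p : ℕ) : 𝓞 ℚ) ∉ w.asIdeal →
      W.HasGoodReductionAt w)
    (hS₁ : ∀ w : HeightOneSpectrum (𝓞 ℚ), w ∉ S₀ → ((p : ℕ) : 𝓞 ℚ) ∉ w.asIdeal →
      W₁.HasGoodReductionAt w)
    {b : ℕ} (hb : (b : ℤ) = r₁ + ∑ w ∈ S₀, ((delta W₁ p w : ℤ) - (delta W p w : ℤ)))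
    (hcert : BranchUnitCoeffAt W p b)
    (V : WeierstrassCurve ℚ) [V.IsElliptic] [V.IsGloballyMinimal] (C : VariableChange ℚ)
    (hC : C • V.quadraticTwist ((-1 : ℚ) ^ (p / 2) * p) = W) (hV : GoodOrd V p)
    {κ : ZpExtension ℚ p} {γ : Field.absoluteGaloisGroup ℚ} {N : ℕ} [NeZero N]
    {f : CuspForm (Gamma0 N) 2}
    (hκ : κ.IsCyclotomic) (hγ : κ.IsTopGenerator γ) (hcv : IsCyclotomicVariable p γ)
    (hf : IsNewformOf V f) (D : W.SelmerDualData κ γ) (D₁ : W₁.SelmerDualData κ γ) (ϖ : ℚ)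
    (hϖ : if Even (p / 2) then (ϖ : ℝ) * V.realPeriodRat = plusPeriod f
      else (ϖ : ℝ) * V.imaginaryPeriodRat = minusPeriod f) :
    (D.IsTorsion ∧ ∃ (g : IwasawaAlgebra p) (u : ℤ_[p]ˣ), D.charIdeal = Ideal.span {g} ∧
      iwasawaToPowerSeries p g =
        PowerSeries.C (((u : ℤ_[p]) : ℚ_[p]) * (ϖ : ℚ_[p])) *
          (if Even (p / 2) then padicLFunctionBranch f ((unitRoot V p : ℤ_[p]) : ℚ_[p]) (p / 2)
            else padicLFunctionMinusBranch f ((unitRoot V p : ℤ_[p]) : ℚ_[p]) (p / 2)) ∧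
      D.mu = 0 ∧ lambdaInvariant p D.X = b) ∧ D₁.mu = 0 ∧ lambdaInvariant p D₁.X = r₁ := by
  haveI : Module.Finite (IwasawaAlgebra p) D.X :=
    SelmerDualData.module_finite_of_isCyclotomic (W := W) (κ := κ) hκ D hγ
  haveI : Module.Finite (IwasawaAlgebra p) D₁.X :=
    SelmerDualData.module_finite_of_isCyclotomic (W := W₁) (κ := κ) hκ D₁ hγ
  -- the partner's torsion and `μ = 0 ⟹ r₁ ≤ λ` from Kato alone (FILE 3 §2)
  obtain ⟨hX₁t, hr₁lam⟩ :=
    hX₁.isTorsion_and_le_lambdaInvariant_of_katoHalf hK hmodD hsurj₁ hr₁ hκ hγ hcv D₁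
  -- `μ(X(E)) = 0` at `E` from Kato half + the unit coefficient, transferred to the partner (FILE 1 §2)
  obtain ⟨hXt, hmu⟩ := hX.isTorsion_and_mu_zero_of_katoHalf_of_coeffCert hK he hsurj hcert V C hC hV
    hκ hγ hcv hf D ϖ hϖ
  have hmu₁ : D₁.mu = 0 :=
    mu_eq_zero_of_epw_of_typeGOrd_potMult hEPW hT40 hT41 hX.addv.1 hX.typeGOrd hX.addv.2 he
      (ClassX4M.potMult W₁ p hX₁) hX.classX4.2.2 hT S₀ hS₀ hS hS₁ hκ hγ hcv D D₁ hXt hX₁t hmu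
  exact hX.mainConjecture_of_katoHalf_of_coeffCert_of_epw_of_multPartner hK hEPW hT40 hT41 he hsurj hX₁
    hT S₀ hS₀ hS hS₁ hb hcert V C hC hV hκ hγ hcv hf D D₁ hX₁t (hr₁lam hmu₁) ϖ hϖ

/-- **K-C′ with an X4♯(G-ord) ∩ `I₀*` ∧ surj(p) partner in RANK currency** — n1011-p10's
`ClassX4Gord.mainConjecture_of_katoHalf_of_coeffCert_of_epw_of_torsionIso` with the per-datum partner
inputs (`D₁` torsion, `r₁ ≤ λ(X(E₁))`) REPLACED by `ρ̄_{E₁,p}` onto, `hmodD` and `r₁ ≤ rank E₁(ℚ)`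
(FILE 1 §1; `μ = 0` transferred from `E` by `ClassX4Gord.mu_eq_zero_of_epw_of_torsionIso`). READING OF
RECORD (referee 1 proviso P1) as above.
[cite: EmertonPollackWeston2006, Thm. 3.3.2, Thm. 3.3.3 (2) (arXiv:math/0404484 p. 19), Lemma 5.1.5 (p. 30), p. 3]
[cite: Kato2004Asterisque, Thm. 17.4 (3) (p. 273)] [cite: GreenbergVatsal2000, Thm. (1.4) and §2 p. 26] -/
theorem ClassX4Gord.mainConjecture_of_katoHalf_of_coeffCert_of_epw_of_torsionIso_rank
    (hK : Wuthrich2014.kato_halfEigenCharIdeal_dvd_cyclotomicPrime_of_surjective)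
    (hEPW : muLambdaAlg_transfer_of_torsionIso_potOrd)
    (hmodD : nonempty_modularParametrizationData)
    (hX : ClassX4Gord W p) (he : semistabilityIndex W p = 2) (hsurj : Surj W p)
    {W₁ : WeierstrassCurve ℚ} [W₁.IsElliptic] [W₁.IsGloballyMinimal]
    (hX₁ : ClassX4Gord W₁ p) (he₁ : semistabilityIndex W₁ p = 2) (hsurj₁ : Surj W₁ p) {r₁ : ℕ}
    (hr₁ : r₁ ≤ W₁.mordellWeilRank) (hT : TorsionIso W W₁ p)
    (S₀ : Finset (HeightOneSpectrum (𝓞 ℚ))) (hS₀ : ∀ w ∈ S₀, ((p : ℕ) : 𝓞 ℚ) ∉ w.asIdeal)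
    (hS : ∀ w : HeightOneSpectrum (𝓞 ℚ), w ∉ S₀ → ((p : ℕ) : 𝓞 ℚ) ∉ w.asIdeal →
      W.HasGoodReductionAt w)
    (hS₁ : ∀ w : HeightOneSpectrum (𝓞 ℚ), w ∉ S₀ → ((p : ℕ) : 𝓞 ℚ) ∉ w.asIdeal →
      W₁.HasGoodReductionAt w)
    {b : ℕ} (hb : (b : ℤ) = r₁ + ∑ w ∈ S₀, ((delta W₁ p w : ℤ) - (delta W p w : ℤ)))
    (hcert : BranchUnitCoeffAt W p b)
    (V : WeierstrassCurve ℚ) [V.IsElliptic] [V.IsGloballyMinimal] (C : VariableChange ℚ)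
    (hC : C • V.quadraticTwist ((-1 : ℚ) ^ (p / 2) * p) = W) (hV : GoodOrd V p)
    {κ : ZpExtension ℚ p} {γ : Field.absoluteGaloisGroup ℚ} {N : ℕ} [NeZero N]
    {f : CuspForm (Gamma0 N) 2}
    (hκ : κ.IsCyclotomic) (hγ : κ.IsTopGenerator γ) (hcv : IsCyclotomicVariable p γ)
    (hf : IsNewformOf V f) (D : W.SelmerDualData κ γ) (D₁ : W₁.SelmerDualData κ γ) (ϖ : ℚ)
    (hϖ : if Even (p / 2) then (ϖ : ℝ) * V.realPeriodRat = plusPeriod f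
      else (ϖ : ℝ) * V.imaginaryPeriodRat = minusPeriod f) :
    (D.IsTorsion ∧ ∃ (g : IwasawaAlgebra p) (u : ℤ_[p]ˣ), D.charIdeal = Ideal.span {g} ∧
      iwasawaToPowerSeries p g =
        PowerSeries.C (((u : ℤ_[p]) : ℚ_[p]) * (ϖ : ℚ_[p])) *
          (if Even (p / 2) then padicLFunctionBranch f ((unitRoot V p : ℤ_[p]) : ℚ_[p]) (p / 2)
            else padicLFunctionMinusBranch f ((unitRoot V p : ℤ_[p]) : ℚ_[p]) (p / 2)) ∧
      D.mu = 0 ∧ lambdaInvariant p D.X = b) ∧ D₁.mu = 0 ∧ lambdaInvariant p D₁.X = r₁ := by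
  haveI : Module.Finite (IwasawaAlgebra p) D.X :=
    SelmerDualData.module_finite_of_isCyclotomic (W := W) (κ := κ) hκ D hγ
  haveI : Module.Finite (IwasawaAlgebra p) D₁.X :=
    SelmerDualData.module_finite_of_isCyclotomic (W := W₁) (κ := κ) hκ D₁ hγ
  obtain ⟨hX₁t, hr₁lam⟩ :=
    hX₁.isTorsion_and_le_lambdaInvariant_of_katoHalf hK hmodD he₁ hsurj₁ hr₁ hκ hγ hcv D₁
  obtain ⟨hXt, hmu⟩ := hX.isTorsion_and_mu_zero_of_katoHalf_of_coeffCert hK he hsurj hcert V C hC hV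
    hκ hγ hcv hf D ϖ hϖ
  have hmu₁ : D₁.mu = 0 :=
    hX.mu_eq_zero_of_epw_of_torsionIso hEPW he hX₁ he₁ hX.classX4.2.2 hT S₀ hS₀ hS hS₁ hκ hγ hcv D D₁
      hXt hX₁t hmu
  exact hX.mainConjecture_of_katoHalf_of_coeffCert_of_epw_of_torsionIso hK hEPW he hsurj hX₁ he₁ hT S₀
    hS₀ hS hS₁ hb hcert V C hC hV hκ hγ hcv hf D D₁ hX₁t (hr₁lam hmu₁) ϖ hϖ

end MainConjecture

end Summit.BirchSwinnertonDyer.Rank1Residual.Additive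

end
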